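import Summits.ResolutionOfSingularities.ResolutionOfSingularities.Theorems.WeightedInvariantIota3CurveFracTieZeroIsolatedHolds
import Summits.ResolutionOfSingularities.ResolutionOfSingularities.Theorems.WeightedInvariantKeyRungThreeOfDropCurveFracTieZeroSigma
import HarnessLib

/-!
# The curve regime of (D-b³) is cut to the single `σ`-comparison (SIGMA) — gap list of record hD + (D-b³-point) + (SIGMA) for
# `stub_keyRungGrHomLE_three` (door `HypersurfaceCentreConstruction`, stmt-ResolutionOfSingularities-19897)

Helper for `stub_keyRungGrHomLE_three` (def-free, `--supports 19897`).  Final assembly of this hand's files …Iota3CurveFracTieZeroSigmaReduction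
((D-b³-curve-FRAC-TIE-ZERO) ⟸ (ISO) + (SIGMA)), …KeyRungThreeOfDropCurveFracTieZeroSigma (order letter stationary; gap list with (ISO)+(SIGMA))
and …Iota3CurveFracTieZeroIsolatedHolds ((ISO) PROVED).

* **`Iota3.curveFracTieZero_of_sigma`**, **`keyRungGrHomLE_three_of_tieDescent_point_sigma`** (GAP LIST OF RECORD) and its (c11)-form
  **`keyRungGrHomLE_three_of_c11_point_sigma`** — `KeyRungGrHomLE 3 p ⟸` hD (resp. (c11)≤3) + (D-b³-point) [the crux, untouched] +
  **(SIGMA)**: in the setting of hand -9's (D-b³-curve-FRAC-TIE-ZERO) (curve centre `P = (x, y) ≠ 𝔪` of a three-dimensional door position with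
  `S`-presented AQS germ `(y/1, x/1; r, q; rν)`, `q ≥ 2`, `b = ⌊r/q⌋ ≥ 1`, `J₃ᵗ = 𝒥((y,x);(b,1))`, `f ∈ 𝒥_{bν} ∩ 𝔪^ν ∖ 𝔪^{ν+1}` tied at
  `λ = 0`, ANY presentation `(u, w)`, THE pinned `t`-homogeneous successor `𝔫 = (t⁻¹, z, W)`, `y = (t⁻¹)^b W`, with its regular-threefold
  datum), prove ONLY the drop of the flag-slope letter **`iotaSigma (B_𝔫) (g/1) < iotaSigma (S_P) (f/1)`** — `σ` of the transform at the
  pinned point against the TRANSVERSAL `σ` of the plane-curve germ `f/1 ∈ S_P` at the centre (expected `(ν!·r/q ; ω)`).  The letters `ν`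
  (stationary), `ε = τ = 0` (both sides), the cylinder readings and the ISOLATION of the transform are all PROVED; by …SigmaReduction the
  `σ`-drop is also NECESSARY for the `ι₃ᵗ`-drop at this successor.  [Expected route (TIE-LOCUS §2, CURVE-TIE §3 (ii)): a two-flag of `B_𝔫`
  reaching a ratio `> 1` forces `in_ν(g) = c·ℓ^ν` (tangent-cone dichotomy, `RatContact.…`), hence `ℓ = αW̄ + βT̄`; for `W`-led flags the
  ratio is `< r/q` by AQS-tie-freeness downstairs (`τ(S, f) = 0`); when no flag reaches ratio `> 1`, `σ₁ ≤ ν! < ν!·r/q`.]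

[OURS · L1 W4.3 · audit glue; AI work, weaker than expert review; nothing here is a statement of the manuscript under review
(Hironaka 2017, [claim: Hironaka2017, status: under-review]).]

## References

* D. Abramovich, M. Temkin, J. Włodarczyk, *Functorial embedded resolution via weighted blowings up*, Algebra & Number Theory 18 (2024), §5.
  [AbramovichTemkinWlodarczyk2024]
* D. Abramovich, M. H. Quek, B. Schober, arXiv:2507.01232 (2025), Thm 1.3 (3), Thm 3.5. [AbramovichQuekSchober2025]
* hand -9, TIE-LOCUS.md; hand -8, CURVE-TIE.md (crux directory; OURS).
-/

noncomputable section

set_option linter.dupNamespace false -- mandated namespace of this single-conjunct summit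

open IsLocalRing Literature.AlgebraicGeometry.Resolution
open Summit.ResolutionOfSingularities.ResolutionOfSingularities.Theorems
open Summit.ResolutionOfSingularities.ResolutionOfSingularities.Theorems.ContactCylinder

namespace Summit.ResolutionOfSingularities.ResolutionOfSingularities.Cruxes.HypersurfaceCentreConstruction.LocalEngine

namespace Iota3

/-! ## §3 (D-b³-curve-FRAC-TIE-ZERO) ⟸ (SIGMA); the gap list of record -/

/-- **(D-b³-curve-FRAC-TIE-ZERO) ⟸ (SIGMA)**, verbatim binders of hand -9's clause with the conclusion replaced by the `σ`-comparison
`iotaSigma (B_𝔫) (g/1) < iotaSigma (S_P) (f/1)`. [OURS · L1 W4.3 · TIE-LOCUS §2 settled up to σ] [cite: AbramovichTemkinWlodarczyk2024, §5] -/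
theorem curveFracTieZero_of_sigma (p : ℕ)
    (hSIGMA : ∀ (k₀ : Type) [Field k₀] [CharP k₀ p] [PerfectField k₀]
      (S : Type) [CommRing S] [Algebra k₀ S] [Algebra.EssFiniteType k₀ S] [IsRegularLocalRing S]
      (f : S), ringKrullDim S = 3 → f ≠ 0 → f ∈ (maximalIdeal S) ^ 2 →
      ∀ (P : Ideal S) [P.IsPrime], IsRegularLocalRing (S ⧸ P) → f ∈ P →
        topStratum iotaOrdEpsTau S f = {𝔮 | P ≤ 𝔮.asIdeal} → ¬ ringKrullDim (Localization.AtPrime P) ≤ 1 →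
        P ≠ maximalIdeal S →
        ∀ (x y z : S) (q r ν : ℕ) (_ : (Ideal.span ({x, y} : Set S)).IsPrime), Ideal.span {x, y, z} = maximalIdeal S →
          P = Ideal.span {x, y} → 2 ≤ q → q ≤ r → 1 ≤ ν → f ∈ maximalIdeal S ^ ν → f ∉ maximalIdeal S ^ (ν + 1) →
          IsLexMaxWeightedCentreGerm (Localization.AtPrime (Ideal.span ({x, y} : Set S)))
            (Ideal.span {algebraMap S (Localization.AtPrime (Ideal.span ({x, y} : Set S))) f})
            ![algebraMap S (Localization.AtPrime (Ideal.span ({x, y} : Set S))) y,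
              algebraMap S (Localization.AtPrime (Ideal.span ({x, y} : Set S))) x] ![r, q] (r * ν) →
          1 ≤ r / q → f ∈ weightedMonomialIdeal ![y, x] ![r / q, 1] (r / q * ν) →
          (∀ m : ℕ, jFlatT S f m = weightedMonomialIdeal ![y, x] ![r / q, 1] m) →
        ∀ (n : ℕ) (u : Fin n → S) (w : Fin n → ℕ),
          Ideal.span (Set.range u) = maximalIdeal S → (maximalIdeal S).spanFinrank = n → (∃ i, 0 < w i) →
          Ideal.span {x | ∃ i, 0 < w i ∧ x = u i} = P →
          (∀ m : ℕ, weightedMonomialIdeal u w m = jFlatT S f m) →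
          ∀ (𝔫 : Ideal (cobordantAlgebra' u w)) [𝔫.IsPrime], IsTHomogeneous u w 𝔫 → cobordantT' u w ∈ 𝔫 →
            (maximalIdeal S).map (algebraMap S (cobordantAlgebra' u w)) ≤ 𝔫 →
            ¬ extReesAlgebra.vertexIdeal (weightedMonomialIdeal u w) ≤ 𝔫 →
            ∀ (a : ℕ) (g : cobordantAlgebra' u w), algebraMap S (cobordantAlgebra' u w) f = cobordantT' u w ^ a * g →
              ¬ cobordantT' u w ∣ g →
              algebraMap (cobordantAlgebra' u w) (Localization.AtPrime 𝔫) g ∈ maximalIdeal (Localization.AtPrime 𝔫) ^ 2 →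
              f ∈ weightedMonomialIdeal ![x, y, z] ![1, r / q + 1, 1] ((r / q + 1) * ν) →
              ∀ W : cobordantAlgebra' u w, algebraMap S (cobordantAlgebra' u w) y = cobordantT' u w ^ (r / q) * W →
                𝔫 = Ideal.span {cobordantT' u w, algebraMap S (cobordantAlgebra' u w) z, W} →
                IsRegularLocalRing (Localization.AtPrime 𝔫) → ringKrullDim (Localization.AtPrime 𝔫) = (3 : ℕ) →
                Ideal.span {algebraMap _ (Localization.AtPrime 𝔫) (cobordantT' u w),
                  algebraMap _ (Localization.AtPrime 𝔫) (algebraMap S (cobordantAlgebra' u w) z),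
                  algebraMap _ (Localization.AtPrime 𝔫) W} = maximalIdeal (Localization.AtPrime 𝔫) →
              iotaSigma (Localization.AtPrime 𝔫) (algebraMap (cobordantAlgebra' u w) (Localization.AtPrime 𝔫) g) <
                iotaSigma (Localization.AtPrime P) (algebraMap S (Localization.AtPrime P) f)) :
    ∀ (k₀ : Type) [Field k₀] [CharP k₀ p] [PerfectField k₀]
      (S : Type) [CommRing S] [Algebra k₀ S] [Algebra.EssFiniteType k₀ S] [IsRegularLocalRing S]
      (f : S), ringKrullDim S = 3 → f ≠ 0 → f ∈ (maximalIdeal S) ^ 2 →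
      ∀ (P : Ideal S) [P.IsPrime], IsRegularLocalRing (S ⧸ P) → f ∈ P →
        topStratum iotaOrdEpsTau S f = {𝔮 | P ≤ 𝔮.asIdeal} → ¬ ringKrullDim (Localization.AtPrime P) ≤ 1 →
        P ≠ maximalIdeal S →
        ∀ (x y z : S) (q r ν : ℕ) (_ : (Ideal.span ({x, y} : Set S)).IsPrime), Ideal.span {x, y, z} = maximalIdeal S →
          P = Ideal.span {x, y} → 2 ≤ q → q ≤ r → 1 ≤ ν → f ∈ maximalIdeal S ^ ν → f ∉ maximalIdeal S ^ (ν + 1) →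
          IsLexMaxWeightedCentreGerm (Localization.AtPrime (Ideal.span ({x, y} : Set S)))
            (Ideal.span {algebraMap S (Localization.AtPrime (Ideal.span ({x, y} : Set S))) f})
            ![algebraMap S (Localization.AtPrime (Ideal.span ({x, y} : Set S))) y,
              algebraMap S (Localization.AtPrime (Ideal.span ({x, y} : Set S))) x] ![r, q] (r * ν) →
          1 ≤ r / q → f ∈ weightedMonomialIdeal ![y, x] ![r / q, 1] (r / q * ν) →
          (∀ m : ℕ, jFlatT S f m = weightedMonomialIdeal ![y, x] ![r / q, 1] m) →
        ∀ (n : ℕ) (u : Fin n → S) (w : Fin n → ℕ),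
          Ideal.span (Set.range u) = maximalIdeal S → (maximalIdeal S).spanFinrank = n → (∃ i, 0 < w i) →
          Ideal.span {x | ∃ i, 0 < w i ∧ x = u i} = P →
          (∀ m : ℕ, weightedMonomialIdeal u w m = jFlatT S f m) →
          ∀ (𝔫 : Ideal (cobordantAlgebra' u w)) [𝔫.IsPrime], IsTHomogeneous u w 𝔫 → cobordantT' u w ∈ 𝔫 →
            (maximalIdeal S).map (algebraMap S (cobordantAlgebra' u w)) ≤ 𝔫 →
            ¬ extReesAlgebra.vertexIdeal (weightedMonomialIdeal u w) ≤ 𝔫 →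
            ∀ (a : ℕ) (g : cobordantAlgebra' u w), algebraMap S (cobordantAlgebra' u w) f = cobordantT' u w ^ a * g →
              ¬ cobordantT' u w ∣ g →
              algebraMap (cobordantAlgebra' u w) (Localization.AtPrime 𝔫) g ∈ maximalIdeal (Localization.AtPrime 𝔫) ^ 2 →
              f ∈ weightedMonomialIdeal ![x, y, z] ![1, r / q + 1, 1] ((r / q + 1) * ν) →
              ∀ W : cobordantAlgebra' u w, algebraMap S (cobordantAlgebra' u w) y = cobordantT' u w ^ (r / q) * W →
                𝔫 = Ideal.span {cobordantT' u w, algebraMap S (cobordantAlgebra' u w) z, W} →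
                IsRegularLocalRing (Localization.AtPrime 𝔫) → ringKrullDim (Localization.AtPrime 𝔫) = (3 : ℕ) →
                Ideal.span {algebraMap _ (Localization.AtPrime 𝔫) (cobordantT' u w),
                  algebraMap _ (Localization.AtPrime 𝔫) (algebraMap S (cobordantAlgebra' u w) z),
                  algebraMap _ (Localization.AtPrime 𝔫) W} = maximalIdeal (Localization.AtPrime 𝔫) →
              iotaFlatT (Localization.AtPrime 𝔫) (algebraMap (cobordantAlgebra' u w) (Localization.AtPrime 𝔫) g) <
                iotaFlatT S f := by
  refine curveFracTieZero_of_iso_sigma p ?_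
  intro k₀ _ _ _ S _ _ _ _ f hd hf0 hf2 P _ hreg hfP hE hP1 hPm x y z q r ν hPxy hxyz hPeq hq2 hqr hν1 hfν hfν1 hlex hb1 hadm hJ
    n u w h1 h2 h3 h4 h5 𝔫 _ hhom hT hM hV a g hfg hTg hg2 hft0 W hW h𝔫 hR1 hR2 hR3
  refine ⟨?_, hSIGMA k₀ S f hd hf0 hf2 P hreg hfP hE hP1 hPm x y z q r ν hPxy hxyz hPeq hq2 hqr hν1 hfν hfν1 hlex hb1 hadm hJ n u w h1 h2
    h3 h4 h5 𝔫 hhom hT hM hV a g hfg hTg hg2 hft0 W hW h𝔫 hR1 hR2 hR3⟩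
  classical
  haveI := hR1
  have hd3 : ringKrullDim S = (3 : ℕ) := by rw [hd]; rfl
  have hrk : (maximalIdeal S).spanFinrank = 3 := by
    have h := IsRegularLocalRing.spanFinrank_maximalIdeal (R := S)
    rw [hd3] at h
    exact_mod_cast h
  have hyxz : Ideal.span (Set.range ![y, x, z]) = maximalIdeal S := by rw [range_three, Set.insert_comm]; exact hxyz
  -- the AQS-adapted normal form `f = c y^ν + h`
  obtain ⟨_, hlex'⟩ := exists_isLexMax_of_eq hPeq.symm hlex
  have hcop' : Nat.Coprime r q := by simpa using hlex'.2.2.1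
  have hndvd : ¬ q ∣ r := fun hdvd => by
    have h1 : Nat.gcd r q = 1 := hcop'
    rw [Nat.gcd_eq_right hdvd] at h1
    omega
  have hsup := mem_span_pow_sup_of_curve_lexMax_frac hd P hPeq.symm hxyz hν1 hndvd hlex'
  obtain ⟨c, h, hc, hh, hf⟩ := exists_normalForm_of_mem_sup hyxz hb1 hsup hfν1
  have hpres : ∀ m : ℕ, weightedMonomialIdeal u w m = weightedMonomialIdeal ![y, x] ![r / q, 1] m := fun m => by rw [h5 m, hJ m]
  -- the order letter is stationary
  have hgν : algebraMap (cobordantAlgebra' u w) (Localization.AtPrime 𝔫) g ∈ maximalIdeal (Localization.AtPrime 𝔫) ^ ν :=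
    transform_mem_pow_of_mem_tieZero hyxz hrk Nat.one_pos hb1 hfν1 hadm hft0 u w hpres 𝔫 hM W hW h𝔫 hR1 hR2 hR3 hfg hTg
  have hgν1 : algebraMap (cobordantAlgebra' u w) (Localization.AtPrime 𝔫) g ∉ maximalIdeal (Localization.AtPrime 𝔫) ^ (ν + 1) :=
    transform_not_mem_pow_succ_of_normalForm hyxz hrk Nat.one_pos hb1 hfν1 hadm hc hh hf u w hpres 𝔫 W hW hR1 hR2 hR3 hfg hTg
  have hord : iotaOrd (Localization.AtPrime 𝔫) (algebraMap (cobordantAlgebra' u w) (Localization.AtPrime 𝔫) g) = iotaOrd S f := by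
    rw [(iotaOrd_eq_natCast_iff (Localization.AtPrime 𝔫) (algebraMap (cobordantAlgebra' u w) (Localization.AtPrime 𝔫) g) ν).mpr
      ⟨hgν, hgν1⟩, (iotaOrd_eq_natCast_iff S f ν).mpr ⟨hfν, hfν1⟩]
  exact isIsolatedPosition_transform p k₀ S hd hf0 hf2 P hfP hE hP1 hPm hyxz hrk hPeq hb1 hfν hfν1 hadm hc hh hf u w hpres h5 𝔫 hV W
    hW h𝔫 hfg hTg hord

end Iota3

open Iota3

/-- **GAP LIST OF RECORD for `stub_keyRungGrHomLE_three` — hD + (D-b³-point) + (SIGMA)** (module docstring): the curve regime of (D-b³)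
costs exactly ONE comparison of the flag-slope letter, `σ(B_𝔫, g/1) < σ(S_P, f/1)`, at the pinned regular local threefold per fractional-slope
curve centre tied at `λ = 0`; the letters `ν`, `ε`, `τ`, the cylinder readings and the isolation of the transform are PROVED.
[OURS · L1 W4.3 · audit glue] -/
theorem keyRungGrHomLE_three_of_tieDescent_point_sigma (p : ℕ)
    (hD : ∀ (T T' : Type) [CommRing T] [IsRegularLocalRing T] [CommRing T'] [IsRegularLocalRing T'] [Algebra T T']
      [IsLocalHom (algebraMap T T')] [Algebra.FormallySmooth T T'] [Algebra.EssFiniteType T T'] (g : T),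
      ringKrullDim T' ≤ 3 → IsTiePosition T' (algebraMap T T' g) → IsTiePosition T g)
    (hPOINT : ∀ (k₀ : Type) [Field k₀] [CharP k₀ p] [PerfectField k₀]
      (S : Type) [CommRing S] [Algebra k₀ S] [Algebra.EssFiniteType k₀ S] [IsRegularLocalRing S]
      (f : S), ringKrullDim S = 3 → f ≠ 0 → f ∈ (maximalIdeal S) ^ 2 →
      ∀ (P : Ideal S) [P.IsPrime], IsRegularLocalRing (S ⧸ P) → f ∈ P →
        topStratum iotaOrdEpsTau S f = {𝔮 | P ≤ 𝔮.asIdeal} → ¬ ringKrullDim (Localization.AtPrime P) ≤ 1 →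
        P = maximalIdeal S →
        ∀ (n : ℕ) (u : Fin n → S) (w : Fin n → ℕ),
          Ideal.span (Set.range u) = maximalIdeal S → (maximalIdeal S).spanFinrank = n → (∃ i, 0 < w i) →
          Ideal.span {x | ∃ i, 0 < w i ∧ x = u i} = P →
          (∀ m : ℕ, weightedMonomialIdeal u w m = jFlatT S f m) →
          ∀ (𝔫 : Ideal (cobordantAlgebra' u w)) [𝔫.IsPrime], IsTHomogeneous u w 𝔫 → cobordantT' u w ∈ 𝔫 →
            (maximalIdeal S).map (algebraMap S (cobordantAlgebra' u w)) ≤ 𝔫 →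
            ¬ extReesAlgebra.vertexIdeal (weightedMonomialIdeal u w) ≤ 𝔫 →
            ∀ (a : ℕ) (g : cobordantAlgebra' u w), algebraMap S (cobordantAlgebra' u w) f = cobordantT' u w ^ a * g →
              ¬ cobordantT' u w ∣ g →
              algebraMap (cobordantAlgebra' u w) (Localization.AtPrime 𝔫) g ∈ maximalIdeal (Localization.AtPrime 𝔫) ^ 2 →
              iotaFlatT (Localization.AtPrime 𝔫) (algebraMap (cobordantAlgebra' u w) (Localization.AtPrime 𝔫) g) <
                iotaFlatT S f)
    (hSIGMA : ∀ (k₀ : Type) [Field k₀] [CharP k₀ p] [PerfectField k₀]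
      (S : Type) [CommRing S] [Algebra k₀ S] [Algebra.EssFiniteType k₀ S] [IsRegularLocalRing S]
      (f : S), ringKrullDim S = 3 → f ≠ 0 → f ∈ (maximalIdeal S) ^ 2 →
      ∀ (P : Ideal S) [P.IsPrime], IsRegularLocalRing (S ⧸ P) → f ∈ P →
        topStratum iotaOrdEpsTau S f = {𝔮 | P ≤ 𝔮.asIdeal} → ¬ ringKrullDim (Localization.AtPrime P) ≤ 1 →
        P ≠ maximalIdeal S →
        ∀ (x y z : S) (q r ν : ℕ) (_ : (Ideal.span ({x, y} : Set S)).IsPrime), Ideal.span {x, y, z} = maximalIdeal S →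
          P = Ideal.span {x, y} → 2 ≤ q → q ≤ r → 1 ≤ ν → f ∈ maximalIdeal S ^ ν → f ∉ maximalIdeal S ^ (ν + 1) →
          IsLexMaxWeightedCentreGerm (Localization.AtPrime (Ideal.span ({x, y} : Set S)))
            (Ideal.span {algebraMap S (Localization.AtPrime (Ideal.span ({x, y} : Set S))) f})
            ![algebraMap S (Localization.AtPrime (Ideal.span ({x, y} : Set S))) y,
              algebraMap S (Localization.AtPrime (Ideal.span ({x, y} : Set S))) x] ![r, q] (r * ν) →
          1 ≤ r / q → f ∈ weightedMonomialIdeal ![y, x] ![r / q, 1] (r / q * ν) →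
          (∀ m : ℕ, jFlatT S f m = weightedMonomialIdeal ![y, x] ![r / q, 1] m) →
        ∀ (n : ℕ) (u : Fin n → S) (w : Fin n → ℕ),
          Ideal.span (Set.range u) = maximalIdeal S → (maximalIdeal S).spanFinrank = n → (∃ i, 0 < w i) →
          Ideal.span {x | ∃ i, 0 < w i ∧ x = u i} = P →
          (∀ m : ℕ, weightedMonomialIdeal u w m = jFlatT S f m) →
          ∀ (𝔫 : Ideal (cobordantAlgebra' u w)) [𝔫.IsPrime], IsTHomogeneous u w 𝔫 → cobordantT' u w ∈ 𝔫 →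
            (maximalIdeal S).map (algebraMap S (cobordantAlgebra' u w)) ≤ 𝔫 →
            ¬ extReesAlgebra.vertexIdeal (weightedMonomialIdeal u w) ≤ 𝔫 →
            ∀ (a : ℕ) (g : cobordantAlgebra' u w), algebraMap S (cobordantAlgebra' u w) f = cobordantT' u w ^ a * g →
              ¬ cobordantT' u w ∣ g →
              algebraMap (cobordantAlgebra' u w) (Localization.AtPrime 𝔫) g ∈ maximalIdeal (Localization.AtPrime 𝔫) ^ 2 →
              f ∈ weightedMonomialIdeal ![x, y, z] ![1, r / q + 1, 1] ((r / q + 1) * ν) →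
              ∀ W : cobordantAlgebra' u w, algebraMap S (cobordantAlgebra' u w) y = cobordantT' u w ^ (r / q) * W →
                𝔫 = Ideal.span {cobordantT' u w, algebraMap S (cobordantAlgebra' u w) z, W} →
                IsRegularLocalRing (Localization.AtPrime 𝔫) → ringKrullDim (Localization.AtPrime 𝔫) = (3 : ℕ) →
                Ideal.span {algebraMap _ (Localization.AtPrime 𝔫) (cobordantT' u w),
                  algebraMap _ (Localization.AtPrime 𝔫) (algebraMap S (cobordantAlgebra' u w) z),
                  algebraMap _ (Localization.AtPrime 𝔫) W} = maximalIdeal (Localization.AtPrime 𝔫) →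
              iotaSigma (Localization.AtPrime 𝔫) (algebraMap (cobordantAlgebra' u w) (Localization.AtPrime 𝔫) g) <
                iotaSigma (Localization.AtPrime P) (algebraMap S (Localization.AtPrime P) f)) :
    KeyRungGrHomLE 3 p :=
  keyRungGrHomLE_three_of_tieDescent_point_curveFracTieZero p hD hPOINT (curveFracTieZero_of_sigma p hSIGMA)

/-- **GAP LIST OF RECORD, (c11)-form — (c11)≤3 + (D-b³-point) + (SIGMA).** [OURS · L1 W4.3 · audit glue] -/
theorem keyRungGrHomLE_three_of_c11_point_sigma (p : ℕ) (hc11 : IotaJEssSmoothCompatibleLE 3 iotaFlatT jFlatT)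
    (hPOINT : ∀ (k₀ : Type) [Field k₀] [CharP k₀ p] [PerfectField k₀]
      (S : Type) [CommRing S] [Algebra k₀ S] [Algebra.EssFiniteType k₀ S] [IsRegularLocalRing S]
      (f : S), ringKrullDim S = 3 → f ≠ 0 → f ∈ (maximalIdeal S) ^ 2 →
      ∀ (P : Ideal S) [P.IsPrime], IsRegularLocalRing (S ⧸ P) → f ∈ P →
        topStratum iotaOrdEpsTau S f = {𝔮 | P ≤ 𝔮.asIdeal} → ¬ ringKrullDim (Localization.AtPrime P) ≤ 1 →
        P = maximalIdeal S →
        ∀ (n : ℕ) (u : Fin n → S) (w : Fin n → ℕ),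
          Ideal.span (Set.range u) = maximalIdeal S → (maximalIdeal S).spanFinrank = n → (∃ i, 0 < w i) →
          Ideal.span {x | ∃ i, 0 < w i ∧ x = u i} = P →
          (∀ m : ℕ, weightedMonomialIdeal u w m = jFlatT S f m) →
          ∀ (𝔫 : Ideal (cobordantAlgebra' u w)) [𝔫.IsPrime], IsTHomogeneous u w 𝔫 → cobordantT' u w ∈ 𝔫 →
            (maximalIdeal S).map (algebraMap S (cobordantAlgebra' u w)) ≤ 𝔫 →
            ¬ extReesAlgebra.vertexIdeal (weightedMonomialIdeal u w) ≤ 𝔫 →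
            ∀ (a : ℕ) (g : cobordantAlgebra' u w), algebraMap S (cobordantAlgebra' u w) f = cobordantT' u w ^ a * g →
              ¬ cobordantT' u w ∣ g →
              algebraMap (cobordantAlgebra' u w) (Localization.AtPrime 𝔫) g ∈ maximalIdeal (Localization.AtPrime 𝔫) ^ 2 →
              iotaFlatT (Localization.AtPrime 𝔫) (algebraMap (cobordantAlgebra' u w) (Localization.AtPrime 𝔫) g) <
                iotaFlatT S f)
    (hSIGMA : ∀ (k₀ : Type) [Field k₀] [CharP k₀ p] [PerfectField k₀]
      (S : Type) [CommRing S] [Algebra k₀ S] [Algebra.EssFiniteType k₀ S] [IsRegularLocalRing S]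
      (f : S), ringKrullDim S = 3 → f ≠ 0 → f ∈ (maximalIdeal S) ^ 2 →
      ∀ (P : Ideal S) [P.IsPrime], IsRegularLocalRing (S ⧸ P) → f ∈ P →
        topStratum iotaOrdEpsTau S f = {𝔮 | P ≤ 𝔮.asIdeal} → ¬ ringKrullDim (Localization.AtPrime P) ≤ 1 →
        P ≠ maximalIdeal S →
        ∀ (x y z : S) (q r ν : ℕ) (_ : (Ideal.span ({x, y} : Set S)).IsPrime), Ideal.span {x, y, z} = maximalIdeal S →
          P = Ideal.span {x, y} → 2 ≤ q → q ≤ r → 1 ≤ ν → f ∈ maximalIdeal S ^ ν → f ∉ maximalIdeal S ^ (ν + 1) →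
          IsLexMaxWeightedCentreGerm (Localization.AtPrime (Ideal.span ({x, y} : Set S)))
            (Ideal.span {algebraMap S (Localization.AtPrime (Ideal.span ({x, y} : Set S))) f})
            ![algebraMap S (Localization.AtPrime (Ideal.span ({x, y} : Set S))) y,
              algebraMap S (Localization.AtPrime (Ideal.span ({x, y} : Set S))) x] ![r, q] (r * ν) →
          1 ≤ r / q → f ∈ weightedMonomialIdeal ![y, x] ![r / q, 1] (r / q * ν) →
          (∀ m : ℕ, jFlatT S f m = weightedMonomialIdeal ![y, x] ![r / q, 1] m) →
        ∀ (n : ℕ) (u : Fin n → S) (w : Fin n → ℕ),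
          Ideal.span (Set.range u) = maximalIdeal S → (maximalIdeal S).spanFinrank = n → (∃ i, 0 < w i) →
          Ideal.span {x | ∃ i, 0 < w i ∧ x = u i} = P →
          (∀ m : ℕ, weightedMonomialIdeal u w m = jFlatT S f m) →
          ∀ (𝔫 : Ideal (cobordantAlgebra' u w)) [𝔫.IsPrime], IsTHomogeneous u w 𝔫 → cobordantT' u w ∈ 𝔫 →
            (maximalIdeal S).map (algebraMap S (cobordantAlgebra' u w)) ≤ 𝔫 →
            ¬ extReesAlgebra.vertexIdeal (weightedMonomialIdeal u w) ≤ 𝔫 →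
            ∀ (a : ℕ) (g : cobordantAlgebra' u w), algebraMap S (cobordantAlgebra' u w) f = cobordantT' u w ^ a * g →
              ¬ cobordantT' u w ∣ g →
              algebraMap (cobordantAlgebra' u w) (Localization.AtPrime 𝔫) g ∈ maximalIdeal (Localization.AtPrime 𝔫) ^ 2 →
              f ∈ weightedMonomialIdeal ![x, y, z] ![1, r / q + 1, 1] ((r / q + 1) * ν) →
              ∀ W : cobordantAlgebra' u w, algebraMap S (cobordantAlgebra' u w) y = cobordantT' u w ^ (r / q) * W →
                𝔫 = Ideal.span {cobordantT' u w, algebraMap S (cobordantAlgebra' u w) z, W} →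
                IsRegularLocalRing (Localization.AtPrime 𝔫) → ringKrullDim (Localization.AtPrime 𝔫) = (3 : ℕ) →
                Ideal.span {algebraMap _ (Localization.AtPrime 𝔫) (cobordantT' u w),
                  algebraMap _ (Localization.AtPrime 𝔫) (algebraMap S (cobordantAlgebra' u w) z),
                  algebraMap _ (Localization.AtPrime 𝔫) W} = maximalIdeal (Localization.AtPrime 𝔫) →
              iotaSigma (Localization.AtPrime 𝔫) (algebraMap (cobordantAlgebra' u w) (Localization.AtPrime 𝔫) g) <
                iotaSigma (Localization.AtPrime P) (algebraMap S (Localization.AtPrime P) f)) :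
    KeyRungGrHomLE 3 p :=
  keyRungGrHomLE_three_of_c11_point_curveFracTieZero p hc11 hPOINT (curveFracTieZero_of_sigma p hSIGMA)

end Summit.ResolutionOfSingularities.ResolutionOfSingularities.Cruxes.HypersurfaceCentreConstruction.LocalEngine

end
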